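import Summits.QuantumFields.QCD.Theorems.QuarksAsStableActionStableActionBridgeVacuumSpectralLowerBound

/-!
# Vacuum connected two-point lower bound `λ ^ n |⟪e, B Ω⟫|² ≤ re (⟪Ω, B† T ^ n B Ω⟫ - ⟪Ω, B† Ω⟫ ⟪Ω, B Ω⟫)`
(crux `QuarksAsStableAction.StableActionBridge`, item stmt-QuantumFields-9737, line `Sketch`;
registered stub `vacuum_connected_lower_bound` of the lead skeleton)

The Goldstone atom of clause `IsChiralAtZero`: for transfer data `(T, Ω)` on a complex Hilbert
space `H` (Lüscher's transfer matrix `T`, a positive contraction fixing the unit vacuum `Ω`), a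
*light* one-particle state `e` — a normalised eigenvector `T e = λ e`, `λ : ℝ`, orthogonal to the
vacuum — that couples to `B Ω` forces the vacuum **connected** two-point function of the bounded
observable `B` to be at least `λ ^ n |⟪e, B Ω⟫|²` at every Euclidean time `n`:

  `λ ^ n ‖⟪e, B Ω⟫‖ ² ≤ re (⟪Ω, (B† T ^ n B) Ω⟫ - ⟪Ω, B† Ω⟫ ⟪Ω, B Ω⟫)`.

Proof: with `β = ⟪Ω, B Ω⟫` and the truncated vector `v = B Ω - β Ω`, the connected function
equals `⟪v, T ^ n v⟫` (`T ^ n` is self-adjoint and fixes `Ω`, `‖Ω‖ = 1`), `⟪e, v⟫ = ⟪e, B Ω⟫`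
because `e ⊥ Ω`, and the vacuum spectral lower bound `vacuum_inner_pow_ge_eigen` applies to `v`.
Mathlib's inner product is conjugate-linear in the first argument.
-/

namespace Summit.QuantumFields.QCD.Cruxes.StableActionBridge.Sketch

open scoped InnerProductSpace ComplexOrder
open Literature.Probability.LatticeModels

section Helpers

variable {H : Type*} [NormedAddCommGroup H] [InnerProductSpace ℂ H] [CompleteSpace H]

/-- Truncation identity for the connected two-point function: for a self-adjoint `S` fixing a
unit vector `Ω` and a bounded operator `B`, with `v = B Ω - ⟪Ω, B Ω⟫ Ω`,
`⟪Ω, (B† S B) Ω⟫ - ⟪Ω, B† Ω⟫ ⟪Ω, B Ω⟫ = ⟪v, S v⟫`. [folklore] -/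
private theorem inner_adjoint_mul_mul_sub_eq {S : H →L[ℂ] H} (hS : IsSelfAdjoint S) {Ω : H}
    (hSΩ : S Ω = Ω) (hΩ : ‖Ω‖ = 1) (B : H →L[ℂ] H) :
    ⟪Ω, (ContinuousLinearMap.adjoint B * S * B) Ω⟫_ℂ -
        ⟪Ω, (ContinuousLinearMap.adjoint B) Ω⟫_ℂ * ⟪Ω, B Ω⟫_ℂ =
      ⟪B Ω - ⟪Ω, B Ω⟫_ℂ • Ω, S (B Ω - ⟪Ω, B Ω⟫_ℂ • Ω)⟫_ℂ := by
  have hΩΩ : ⟪Ω, Ω⟫_ℂ = 1 := inner_self_eq_one_of_norm_eq_one hΩ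
  -- `⟪Ω, S (B Ω)⟫ = ⟪S Ω, B Ω⟫ = ⟪Ω, B Ω⟫`
  have h1 : ⟪Ω, S (B Ω)⟫_ℂ = ⟪Ω, B Ω⟫_ℂ := by
    rw [← ContinuousLinearMap.adjoint_inner_left, hS.adjoint_eq, hSΩ]
  have h2 : ⟪B Ω, Ω⟫_ℂ = starRingEnd ℂ ⟪Ω, B Ω⟫_ℂ := (inner_conj_symm _ _).symm
  rw [mul_apply_eq_comp, mul_apply_eq_comp,
    ContinuousLinearMap.adjoint_inner_right, ContinuousLinearMap.adjoint_inner_right,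
    map_sub, map_smul, hSΩ, inner_sub_left, inner_sub_right, inner_sub_right,
    inner_smul_left, inner_smul_left, inner_smul_right, inner_smul_right, h1, h2, hΩΩ]
  ring

end Helpers

/-- **Vacuum connected two-point lower bound** (Goldstone atom, clause `IsChiralAtZero`): for
transfer data `(T, Ω)` on a complex Hilbert space, a bounded observable `B`, a normalised
eigenvector `T e = λ e`, `‖e‖ = 1` with `λ : ℝ` and `⟪Ω, e⟫ = 0`, and any `n : ℕ`,
`λ ^ n ‖⟪e, B Ω⟫‖ ² ≤ re (⟪Ω, (B† T ^ n B) Ω⟫ - ⟪Ω, B† Ω⟫ ⟪Ω, B Ω⟫)`: a light state orthogonal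
to the vacuum bounds the connected two-point function from below. [folklore] -/
theorem vacuum_connected_lower_bound : ∀ (H : Type) [NormedAddCommGroup H] [InnerProductSpace ℂ H] [CompleteSpace H] (D : TransferData H) (B : H →L[ℂ] H) (e : H) (lam : ℝ) (n : ℕ), D.T e = (lam : ℂ) • e → ‖e‖ = 1 → ⟪D.vacuum, e⟫_ℂ = 0 → lam ^ n * ‖⟪e, B D.vacuum⟫_ℂ‖ ^ 2 ≤ (⟪D.vacuum, (ContinuousLinearMap.adjoint B * D.T ^ n * B) D.vacuum⟫_ℂ - ⟪D.vacuum, (ContinuousLinearMap.adjoint B) D.vacuum⟫_ℂ * ⟪D.vacuum, B D.vacuum⟫_ℂ).re := by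
  intro H _ _ _ D B e lam n he hnorm hOe
  have hsa : IsSelfAdjoint (D.T ^ n) := D.isPositive.isSelfAdjoint.pow n
  rw [inner_adjoint_mul_mul_sub_eq hsa (D.pow_apply_vacuum n) D.norm_vacuum B]
  -- `⟪e, v⟫ = ⟪e, B Ω⟫` for the truncated vector `v = B Ω - ⟪Ω, B Ω⟫ Ω`, since `e ⊥ Ω`
  have heΩ : ⟪e, D.vacuum⟫_ℂ = 0 := by rw [← inner_conj_symm, hOe, map_zero]
  have hev : ⟪e, B D.vacuum - ⟪D.vacuum, B D.vacuum⟫_ℂ • D.vacuum⟫_ℂ = ⟪e, B D.vacuum⟫_ℂ := by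
    rw [inner_sub_right, inner_smul_right, heΩ, mul_zero, sub_zero]
  calc lam ^ n * ‖⟪e, B D.vacuum⟫_ℂ‖ ^ 2
      = lam ^ n * ‖⟪e, B D.vacuum - ⟪D.vacuum, B D.vacuum⟫_ℂ • D.vacuum⟫_ℂ‖ ^ 2 := by rw [hev]
    _ ≤ _ := vacuum_inner_pow_ge_eigen H D e _ lam n he hnorm

end Summit.QuantumFields.QCD.Cruxes.StableActionBridge.Sketch
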